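import Literature.MathematicalPhysics.QuantumLattice.TorusPlaquetteDictionaryMap
import Literature.MathematicalPhysics.QuantumLattice.InterClusterKernelIdentification
import Literature.MathematicalPhysics.QuantumLattice.FermionTorusBlockTiling
import Literature.MathematicalPhysics.QuantumLattice.SpinSystem
import HarnessLib

/-!
# The plaquette-boson dictionary map and the `d`-wave pair field: the one-plaquette and inter-plaquette pieces

Local ingredients of clause (e) of the plaquette-boson dictionary (Tsai–Kivelson 2006, App. A; Altman–Auerbach
2002, §II.D: the boson `b_R` is created by the plaquette `d_{x²−y²}` pair operator, `Φᴴ Δ_d Φ = c Σ_R S⁺_R`), for the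
dictionary map `Φ = dictionaryMap M U` of `TorusPlaquetteDictionaryMap` (columns = Koszul product states of plaquette
ground states). Everything is PROVED; no definition and no named fact is introduced:

* `isParityPreserving_plaquetteDWavePair` — the plaquette pair operator `Δ_d^{(R)}` is even;
* `star_plaquetteStates_dotProduct_plaquetteDWavePair_mulVec` — its only matrix element between the two plaquette
  states is `⟨2h| Δ_d^{(R)} |0h⟩ = c(U)` (`plaquetteDWaveOverlap_eq_c`; the others vanish by electron counting);
* `star_col_dotProduct_jwEmbed_plaquetteDWavePair_mulVec_col` — hence the embedded plaquette pair operator at `R` has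
  the matrix elements of `c · S⁺_R` between the columns of `Φ` (an even cluster operator acts on its own factor,
  `jwEmbed_mulVec_prodFamily`, and inner products of product states factor);
* `star_col_dotProduct_annihilation_mul_annihilation_mulVec_col` — a product of two annihilation operators on
  DIFFERENT plaquettes has vanishing matrix elements between the columns of `Φ` (each factor acquires an odd
  electron number: `annihilation_emb_mulVec_prodFamily`);
* `blockOf_ofTorusSite_add_single_ne` — a torus bond `(x, x + eᵢ)` with `xᵢ` odd joins two different plaquettes
  (`M ≥ 2`); `sum_blockFamily_eq_sum_plaqOrbEmb` — block sums over the tree's block family `X ↦ 2c + X`,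
  `c ∈ [0,M)²`, are sums over the plaquette embeddings `plaqOrbEmb M R`.

References: W.-F. Tsai, S. A. Kivelson, PRB 73 (2006) 214510, App. A [cite: TsaiKivelson2006, App. A]; E. Altman,
A. Auerbach, PRB 65 (2002) 104508, §II.D [cite: AltmanAuerbach2002, §II.D]; O. Bratteli, D. W. Robinson, *Operator
Algebras and QSM II* (1997) §5.2.2. All statements are [folklore].
-/

noncomputable section

namespace Literature.MathematicalPhysics.QuantumLattice

open Matrix Finset TwoCluster Literature.Probability.LatticeModels

namespace TorusPlaquette

/-! ### The plaquette pair operator: parity, electron counting, matrix elements -/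

/-- `c_i c_j` is even. [folklore] -/
theorem isParityPreserving_annihilation_mul_annihilation {κ : Type*} [LinearOrder κ] [Fintype κ] (i j : κ) :
    IsParityPreserving (annihilation i * annihilation j) := by
  intro s t h
  rw [Matrix.mul_apply] at h
  obtain ⟨u, -, hu⟩ := Finset.exists_ne_zero_of_sum_ne_zero h
  have h1 := left_ne_zero_of_mul hu
  have h2 := right_ne_zero_of_mul hu
  rw [annihilation_apply] at h1 h2
  by_cases c1 : i ∉ s ∧ u = insert i s
  · by_cases c2 : j ∉ u ∧ t = insert j u
    · rw [c2.2, card_insert_of_notMem c2.1, c1.2, card_insert_of_notMem c1.1]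
      omega
    · rw [if_neg c2] at h2; exact absurd rfl h2
  · rw [if_neg c1] at h1; exact absurd rfl h1

/-- The plaquette `d`-wave pair operator is even. [folklore] -/
theorem isParityPreserving_plaquetteDWavePair : IsParityPreserving plaquetteDWavePair := by
  refine IsParityPreserving.sum fun x _ => IsParityPreserving.sum fun y _ => IsParityPreserving.smul ?_ _
  rw [sub_eq_add_neg]
  exact (isParityPreserving_annihilation_mul_annihilation _ _).add
    (isParityPreserving_annihilation_mul_annihilation _ _).neg

/-- The plaquette pair operator removes two electrons. [folklore] -/
theorem isNParticle_plaquetteDWavePair_mulVec {N : ℕ} {ψ : Fock (Orb PlaquetteSite)} (hψ : IsNParticle (N + 2) ψ) :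
    IsNParticle N (plaquetteDWavePair *ᵥ ψ) := by
  have hcc : ∀ i j : Orb PlaquetteSite, IsNParticle N ((annihilation i * annihilation j) *ᵥ ψ) := by
    intro i j
    rw [← mulVec_mulVec]
    exact IsNParticle.annihilation_mulVec_holds (IsNParticle.annihilation_mulVec_holds hψ j) i
  have hmem : plaquetteDWavePair *ᵥ ψ ∈ nParticleSubmodule N := by
    rw [plaquetteDWavePair, sum_mulVec]
    refine Submodule.sum_mem _ fun x _ => ?_
    rw [sum_mulVec]
    refine Submodule.sum_mem _ fun y _ => ?_
    rw [smul_mulVec, sub_mulVec]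
    exact Submodule.smul_mem _ _ (Submodule.sub_mem _ ((mem_nParticleSubmodule_iff _ _).2 (hcc _ _))
      ((mem_nParticleSubmodule_iff _ _).2 (hcc _ _)))
  exact (mem_nParticleSubmodule_iff _ _).1 hmem

/-- **The only matrix element of `Δ_d^{(R)}` between the plaquette states is `⟨2h| Δ_d^{(R)} |0h⟩ = c(U)`.**
[cite: AltmanAuerbach2002, §II.D] -/
theorem star_plaquetteStates_dotProduct_plaquetteDWavePair_mulVec (U : ℝ) (i j : Fin 2) :
    star (plaquetteStates U i) ⬝ᵥ (plaquetteDWavePair *ᵥ plaquetteStates U j) =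
      if i = 1 ∧ j = 0 then (((plaquettePairCouplings U).c : ℝ) : ℂ) else 0 := by
  by_cases h : i = 1 ∧ j = 0
  · obtain ⟨rfl, rfl⟩ := h
    rw [if_pos ⟨rfl, rfl⟩, ← plaquetteDWaveOverlap_eq_c]
    rfl
  · rw [if_neg h]
    have hj := isNParticle_plaquetteStates U j
    have hi := isNParticle_plaquetteStates U i
    fin_cases i <;> fin_cases j
    · exact dotProduct_eq_zero_of_isNParticle_ne (N := 4) (N' := 2) (by norm_num) hi
        (isNParticle_plaquetteDWavePair_mulVec (by simpa using hj))
    · exact dotProduct_eq_zero_of_isNParticle_ne (N := 4) (N' := 0) (by norm_num) hi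
        (isNParticle_plaquetteDWavePair_mulVec (by simpa using hj))
    · exact absurd ⟨rfl, rfl⟩ h
    · exact dotProduct_eq_zero_of_isNParticle_ne (N := 2) (N' := 0) (by norm_num) hi
        (isNParticle_plaquetteDWavePair_mulVec (by simpa using hj))

/-! ### The embedded plaquette pair operator between columns of `Φ`: the entries of `c · S⁺_R` -/

variable {M : ℕ}

/-- **The embedded plaquette pair operator at `R` has the matrix elements of `c · S⁺` at the spin site of `R`**
between the columns of `Φ`. [cite: TsaiKivelson2006, App. A] -/
theorem star_col_dotProduct_jwEmbed_plaquetteDWavePair_mulVec_col [NeZero M] (U : ℝ) (R : FermionTorus 2 M)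
    (σ' σ : TensorIndex (TorusSite 2 M) 2) :
    star ((plaquettePartition M).prodFamily (plaqFamily U σ')) ⬝ᵥ
        (jwEmbed (plaqOrbEmb M R) plaquetteDWavePair *ᵥ (plaquettePartition M).prodFamily (plaqFamily U σ)) =
      (((plaquettePairCouplings U).c : ℝ) : ℂ) * onSite (FermionTorus.toTorusSite R) (spinRaise 1) σ' σ := by
  classical
  have h := (plaquettePartition M).jwEmbed_mulVec_prodFamily isParityPreserving_plaquetteDWavePair R (plaqFamily U σ)
  rw [plaquettePartition_emb] at h
  rw [h, ClusterProduct.Partition.star_prodFamily_dotProduct_prodFamily,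
    ← Finset.mul_prod_erase _ _ (Finset.mem_univ R), Function.update_self]
  have hrest : ∏ c ∈ Finset.univ.erase R, (star (plaqFamily U σ' c) ⬝ᵥ Function.update (plaqFamily U σ) R
      (plaquetteDWavePair *ᵥ plaqFamily U σ R) c) =
        if ∀ y, y ≠ FermionTorus.toTorusSite R → σ' y = σ y then 1 else 0 := by
    have hfac : ∀ c ∈ Finset.univ.erase R, (star (plaqFamily U σ' c) ⬝ᵥ Function.update (plaqFamily U σ) R
        (plaquetteDWavePair *ᵥ plaqFamily U σ R) c) =
          if σ' (FermionTorus.toTorusSite c) = σ (FermionTorus.toTorusSite c) then 1 else 0 := by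
      intro c hc
      rw [Function.update_of_ne (Finset.ne_of_mem_erase hc)]
      simp only [plaqFamily, star_plaquetteStates_dotProduct]
      by_cases hcc : σ' (FermionTorus.toTorusSite c) = σ (FermionTorus.toTorusSite c)
      · rw [if_pos hcc, if_pos (by rw [hcc])]
      · rw [if_neg hcc, if_neg (fun h' => hcc (Fin.rev_injective h'))]
    rw [Finset.prod_congr rfl hfac]
    by_cases hall : ∀ y, y ≠ FermionTorus.toTorusSite R → σ' y = σ y
    · rw [if_pos hall]
      refine Finset.prod_eq_one fun c hc => if_pos (hall _ fun h' => Finset.ne_of_mem_erase hc ?_)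
      have := congrArg FermionTorus.ofTorusSite h'
      rwa [FermionTorus.ofTorusSite_toTorusSite, FermionTorus.ofTorusSite_toTorusSite] at this
    · rw [if_neg hall]
      obtain ⟨y, hy, hne⟩ : ∃ y, y ≠ FermionTorus.toTorusSite R ∧ σ' y ≠ σ y := by
        by_contra hc
        exact hall fun y hy => by by_contra h'; exact hc ⟨y, hy, h'⟩
      refine Finset.prod_eq_zero (i := FermionTorus.ofTorusSite y) (Finset.mem_erase.2 ⟨fun h' => hy ?_, Finset.mem_univ _⟩) ?_
      · rw [← h', FermionTorus.toTorusSite_ofTorusSite]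
      · rw [if_neg]; simpa using hne
  -- the spin-`½` raising operator has the single entry `⟨↑| S⁺ |↓⟩ = 1`
  have hS : ∀ k l : Fin 2, spinRaise 1 k l = if k = 0 ∧ l = 1 then 1 else 0 := by
    intro k l
    fin_cases k <;> fin_cases l <;> simp [spinRaise]
  rw [hrest, onSite_apply, hS]
  simp only [plaqFamily, star_plaquetteStates_dotProduct_plaquetteDWavePair_mulVec]
  by_cases hall : ∀ y, y ≠ FermionTorus.toTorusSite R → σ' y = σ y
  · rw [if_pos hall, if_pos hall, mul_one]
    have h1 : ((σ' (FermionTorus.toTorusSite R)).rev = 1 ∧ (σ (FermionTorus.toTorusSite R)).rev = 0) ↔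
        (σ' (FermionTorus.toTorusSite R) = 0 ∧ σ (FermionTorus.toTorusSite R) = 1) := by
      constructor
      · rintro ⟨ha, hb⟩
        exact ⟨Fin.rev_injective (by rw [ha]; rfl), Fin.rev_injective (by rw [hb]; rfl)⟩
      · rintro ⟨ha, hb⟩
        rw [ha, hb]
        exact ⟨rfl, rfl⟩
    by_cases hc : σ' (FermionTorus.toTorusSite R) = 0 ∧ σ (FermionTorus.toTorusSite R) = 1
    · rw [if_pos (h1.2 hc), if_pos hc, mul_one]
    · rw [if_neg (fun h' => hc (h1.1 h')), if_neg hc, mul_zero]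
  · rw [if_neg hall, if_neg hall, mul_zero, mul_zero]

/-! ### Two annihilation operators on different plaquettes vanish between columns of `Φ` -/

/-- **A product of annihilation operators on two DIFFERENT plaquettes has no matrix element between columns of `Φ`**
(the factor at the second plaquette acquires an odd electron number). [cite: BratteliRobinsonII1997, §5.2.2] -/
theorem star_col_dotProduct_annihilation_mul_annihilation_mulVec_col [NeZero M] (U : ℝ)
    {o₁ o₂ : Orb (FermionTorus 2 (2 * M))} (hne : (plaquettePartition M).cl o₁ ≠ (plaquettePartition M).cl o₂)
    (σ' σ : TensorIndex (TorusSite 2 M) 2) :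
    star ((plaquettePartition M).prodFamily (plaqFamily U σ')) ⬝ᵥ
        ((annihilation o₁ * annihilation o₂) *ᵥ (plaquettePartition M).prodFamily (plaqFamily U σ)) = 0 := by
  classical
  set P := plaquettePartition M with hP
  set R₁ := P.cl o₁ with hR₁
  set R₂ := P.cl o₂ with hR₂
  have ho₁ : o₁ = P.emb R₁ (P.idx o₁) := (P.emb_cl_idx o₁).symm
  have ho₂ : o₂ = P.emb R₂ (P.idx o₂) := (P.emb_cl_idx o₂).symm
  rw [← mulVec_mulVec, ho₂, P.annihilation_emb_mulVec_prodFamily, ho₁, P.annihilation_emb_mulVec_prodFamily,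
    ClusterProduct.Partition.star_prodFamily_dotProduct_prodFamily]
  refine Finset.prod_eq_zero (Finset.mem_univ R₂) ?_
  -- the factor at `R₂`: `⟨even, (±) odd⟩ = 0`
  set k' := (σ' (FermionTorus.toTorusSite R₂)).rev with hk'
  set k := (σ (FermionTorus.toTorusSite R₂)).rev with hk
  have heven : IsNParticle (4 - 2 * (k' : ℕ)) (plaqFamily U σ' R₂) := isNParticle_plaquetteStates U k'
  have hk4 : 4 - 2 * (k : ℕ) = (3 - 2 * (k : ℕ)) + 1 := by have := k.isLt; omega
  have hodd : IsNParticle (3 - 2 * (k : ℕ)) (annihilation (P.idx o₂) *ᵥ plaqFamily U σ R₂) := by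
    have h0 : IsNParticle ((3 - 2 * (k : ℕ)) + 1) (plaqFamily U σ R₂) := by
      rw [← hk4]; exact isNParticle_plaquetteStates U k
    exact IsNParticle.annihilation_mulVec_holds h0 _
  have hneq : 4 - 2 * (k' : ℕ) ≠ 3 - 2 * (k : ℕ) := by have := k.isLt; have := k'.isLt; omega
  have hne' : R₂ ≠ R₁ := Ne.symm hne
  simp only [Function.update_of_ne hne', lt_irrefl, if_false, Function.update_self]
  split_ifs
  · have hpar : _root_.Literature.MathematicalPhysics.QuantumLattice.parityOp *ᵥ
          (annihilation (P.idx o₂) *ᵥ plaqFamily U σ R₂) =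
        ((-1 : ℂ) ^ (3 - 2 * (k : ℕ))) • (annihilation (P.idx o₂) *ᵥ plaqFamily U σ R₂) :=
      parityOp_mulVec_of_hasParity (hasParity_of_isNParticle hodd)
    rw [hpar, dotProduct_smul, dotProduct_eq_zero_of_isNParticle_ne hneq heven hodd, smul_zero]
  · exact dotProduct_eq_zero_of_isNParticle_ne hneq heven hodd

/-! ### Odd bonds join different plaquettes; block sums over the block family -/

/-- **A torus bond `(x, x + eᵢ)` with `xᵢ` odd joins two different plaquettes** (`M ≥ 2`). [folklore] -/
theorem blockOf_ofTorusSite_add_single_ne [NeZero M] (hM : 2 ≤ M) (x : TorusSite 2 (2 * M)) (i : Fin 2)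
    (hx : ¬ Even (x i).val) :
    blockOf M (FermionTorus.ofTorusSite x) ≠ blockOf M (FermionTorus.ofTorusSite (x + Pi.single i 1)) := by
  intro h
  have hi := congrArg (fun z => ((ofLex z) i : ℕ)) h
  simp only [blockOf_apply_val, FermionTorus.ofLex_ofTorusSite_apply, Pi.add_apply, Pi.single_eq_same] at hi
  obtain ⟨r, hr⟩ := Nat.odd_iff.2 (Nat.mod_two_ne_zero.1 fun h0 => hx (Nat.even_iff.2 h0))
  have hlt : (x i).val < 2 * M := ZMod.val_lt (x i)
  haveI : NeZero (2 * M) := ⟨by omega⟩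
  haveI : Fact (1 < 2 * M) := ⟨by omega⟩
  rw [ZMod.val_add, ZMod.val_one, hr] at hi
  by_cases hwrap : 2 * r + 1 + 1 < 2 * M
  · rw [Nat.mod_eq_of_lt hwrap] at hi
    omega
  · have heq : 2 * r + 1 + 1 = 2 * M := by omega
    rw [heq, Nat.mod_self] at hi
    omega

/-- The coarse sites of side `M` enumerate the block labels `[0, M)²` by their coordinates. [folklore] -/
theorem map_coords_univ (M : ℕ) :
    (Finset.univ : Finset (FermionTorus 2 M)).map ⟨fun R : FermionTorus 2 M => ((ofLex R 0 : ℕ), (ofLex R 1 : ℕ)),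
      fun R R' h => FermionTorus.ext_coord fun j => by
        fin_cases j
        · exact (Prod.mk.inj h).1
        · exact (Prod.mk.inj h).2⟩ = Finset.range M ×ˢ Finset.range M := by
  ext c
  rw [Finset.mem_map, Finset.mem_product, Finset.mem_range, Finset.mem_range]
  constructor
  · rintro ⟨R, -, rfl⟩
    exact ⟨(ofLex R 0).isLt, (ofLex R 1).isLt⟩
  · rintro ⟨h1, h2⟩
    refine ⟨toLex fun i => ⟨![c.1, c.2] i, by fin_cases i <;> simpa⟩, Finset.mem_univ _, ?_⟩
    simp

/-- **Block sums over the block family are sums over the plaquette embeddings**: for the tree's block family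
`f_c : X ↦ 2c + X` (`c ∈ [0, M)²`, as produced by `FermionTorus.exists_blockFamily (2M) 2`), `f_{(R₀,R₁)}` is the
plaquette embedding `plaqSiteEmb M R`, so `Σ_c F(orbEmb (f c)) = Σ_R F(plaqOrbEmb M R)`. [folklore] -/
theorem sum_blockFamily_eq_sum_plaqOrbEmb {α : Type*} [AddCommMonoid α] {f : ℕ × ℕ → (PlaquetteSite ↪o FermionTorus 2 (2 * M))}
    (hf : ∀ c ∈ Finset.range (2 * M / 2) ×ˢ Finset.range (2 * M / 2), ∀ X j,
      (ofLex (f c X) j : ℕ) = ![c.1 * 2, c.2 * 2] j + (ofLex X j : ℕ))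
    (F : (Orb PlaquetteSite ↪o Orb (FermionTorus 2 (2 * M))) → α) :
    ∑ c ∈ Finset.range (2 * M / 2) ×ˢ Finset.range (2 * M / 2), F (orbEmb (f c)) = ∑ R : FermionTorus 2 M, F (plaqOrbEmb M R) := by
  have hM : 2 * M / 2 = M := by omega
  have hfc : ∀ R : FermionTorus 2 M, f ((ofLex R 0 : ℕ), (ofLex R 1 : ℕ)) = plaqSiteEmb M R := by
    intro R
    have hR : ((ofLex R 0 : ℕ), (ofLex R 1 : ℕ)) ∈ Finset.range (2 * M / 2) ×ˢ Finset.range (2 * M / 2) := by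
      rw [hM, Finset.mem_product, Finset.mem_range, Finset.mem_range]
      exact ⟨(ofLex R 0).isLt, (ofLex R 1).isLt⟩
    apply DFunLike.ext
    intro X
    refine FermionTorus.ext_coord fun j => ?_
    rw [hf _ hR X j, plaqSiteEmb_apply, plaqSite_apply_val]
    fin_cases j <;> simp [mul_comm]
  rw [hM, ← map_coords_univ M, Finset.sum_map]
  refine Finset.sum_congr rfl fun R _ => ?_
  simp only [Function.Embedding.coeFn_mk]
  rw [hfc R]
  rfl

end TorusPlaquette

end Literature.MathematicalPhysics.QuantumLattice
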